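import Literature.NumberTheory.LFunctions.ConreyIwaniec2002SpacingMechanism
import Mathlib.NumberTheory.LSeries.RiemannZeta
import HarnessLib

/-!
# Conrey–Iwaniec (2002), §§4–6: the vocabulary of Theorem 6.1 (kernel, cosine transform, off-diagonal series, shifted-convolution hypothesis)

B. Conrey, H. Iwaniec, *Spacing of zeros of Hecke `L`-functions and the class number problem*,
Acta Arith. 103 (2002) 259–312 [held text `paper:arxiv-math_0111012`, chunks p0010–p0017].
DEFINITIONS ONLY, for the cell `landau-siegel/ls-inputs` line
`thm61-cm-convolution` towards the typed named fact `conreyIwaniec2002_proposition64`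
(`ConreyIwaniec2002SpacingMechanism.lean`); the six registered stubs of that line's skeleton
(`SKELETON P64`) are stated over the present vocabulary. Nothing is asserted here.

## What the source prints

**§5 (5.18), §6 (6.1)–(6.3), (6.6)** (p0014:L21–L52). `𝒜(T) = ∫ K(t/T)|A(it)|² dt` with a
non-negative `K`, `K ≥ 1` on `[½, 3]`; "We assume that the cut-off function `K(u)` in the integral
(5.18) is continuous and symetric on `ℝ` with `K(0) = 0` (6.1). Moreover we assume that the
cosine-Fourier transform `L(v) = 2∫₀^∞ K(u)cos(uv)du` (6.2) has fast decaying derivatives,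
specifically `|L^{(j)}(v)| ≤ (1+|v|)^{-4}`, `0 ≤ j ≤ 5` (6.3). Clearly any smooth, symmetric and
compactly supported function on `ℝ ∖ {0}` does satisfy the above conditions up to a constant
factor." `L(0) = 2∫₀^∞ K(u)du` (6.6).

**§6 (6.18)–(6.24), (6.29)** (p0014:L150–p0015:L30, p0015:L130). For smooth `g₁, g₂` supported in
`[X, 2X]`, `X ≥ ½`, with `x^ν|g_j^{(ν)}(x)| ≤ 1`, `ν = 0,1,2` (6.18), and `h ≥ 1`:
`Σ_{m−n=h} λ(m)λ̄(n)g₁(m)g₂(n) = σ(h)∫g₁(x+h)g₂(x)dx + O(Bτ(h)X^{3/4}(log 3X)²)` (6.19);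
`|σ(h)| ≤ C Σ_{d∣h} d^{-1}` (6.20); `Z(s) = Σ_h σ(h)h^{-s}` (6.21) `= ζ(s)z(s)` (6.22);
`D(v) = Σ_{h≥1} σ(h)L(hv)` (6.29). The two examples (p0015:L37–54): for a primitive cusp form
`σ = 0` (Theorem 4.3, `B = k⁴q⁶`); for the Eisenstein series of the cusp `1/v`, `q = vw`, `σ(h)` is
(4.32) with generating series (4.34), `B = q⁶` (Theorem 4.4).

**§4 (4.27)–(4.34)** (p0012:L99–L130): `σ(h) = {v Σ_{(c,q)=v} r_c(h)c^{-2} + w Σ_{(c,q)=w} r_c(h)c^{-2}}L²(1,χ)`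
(4.27) and `Z(s) = {v^{-1}∏_{p∣v}(1−p^{1−s})∏_{p∣w}(1−p^{−s−1}) + w^{-1}∏_{p∣w}(1−p^{1−s})∏_{p∣v}(1−p^{−s−1})}
(ζ_q(2)/ζ(2)) ζ(s)ζ(s+1) L²(1,χ)` (4.34) — the printed display drops the signs `μ(v)`, `μ(w)` which
(4.31) and (4.36) carry; `ζ_q(2)/ζ(2) = ∏_{p∣q}(1−p^{-2})^{-1}/ζ(2) ∈ (0, 1]`.

## Lean rendering / design choices (audit notes)

* `ciL K v` = (6.2) as a `Set.Ioi 0` integral; `IsCIKernel K` = (6.1)–(6.3) with the derivative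
  bounds normalised to constant `1` as printed, PLUS `HasCompactSupport K` (the source's sufficient
  condition) and `ContDiff ℝ 5 (ciL K)` (so that `iteratedDeriv` is the derivative, not junk).
* `ciD K σ v` = (6.29) as a `tsum` over `h ≥ 1`.
* `IsBumpOn X g` = the test functions of (4.18)/(4.23)/(6.18), of class `C²` (the proofs of
  Theorem 4.1 and (4.22)–(4.24) integrate by parts twice; (6.27) feeds constituents of the `C²`
  weight `a` of `IsCutoff`), complex-valued, vanishing off `[X, 2X]`.
* `ShiftedConvolutionBound λ σ B` = (6.19) with the absolute implied constant folded into `B`;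
  the `m−n = h` sum is written over `n ∈ [1, ⌊2X⌋]` (the support of `g₂`).
* `genusZFactor v w s` = the bracket factor of (4.34), `∏_{p∣v}(p^{-1} − p^{-s})∏_{p∣w}(1 − p^{-s-1})`
  (`= v^{-1}∏_{p∣v}(1−p^{1−s})∏_{p∣w}(1−p^{−s−1})` for squarefree `v`).
* `IsCutoff14 a Y` = the class (6.14) of Theorem 6.1 (constant `1`); `Thm61Generic c` = the generic
  evaluation (6.4)–(6.12) with error `c(G₁/T + G₂/(TH) + (Σ|a_n|)²/T³)`; `Thm61ShiftedSum c` =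
  (6.27)–(6.28). These two `Prop`s are the interfaces of the registered sub-stubs S2a/S2b of the
  line's skeleton (stub S2c assembles (6.29)–(6.31) and Corollary 6.2 from them).
* `IsCISigma q ℓ σ` = what §6 uses of `σ` in the two examples: (6.20) in the form
  `|σ(h)| ≤ 2ℓ²σ₋₁(h)` (from (4.32): `|{…}| ≤ (h,v)/v + (h,w)/w ≤ 2`, `ζ_q(2)/ζ(2) ≤ 1`,
  `Σ_{d∣h,(d,q)=1}d^{-1} ≤ σ₋₁(h)`), and EITHER `σ = 0` OR the identity (4.34) on `Re s > 1` with
  `κ ∈ [0,1]` (`= ζ_q(2)/ζ(2)`) and signs `|ε₁|, |ε₂| ≤ 1` (`= μ(v), μ(w)`); `ℓ = L(1,χ)`.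

WHAT THIS IS NOT: no theorem of the source is asserted; in particular neither Theorem 6.1 nor
Theorems 4.3/4.4 nor Proposition 6.4. «The programme SEARCHES and TYPES; no claim about
Landau–Siegel zeros, Theorems 1–2 of arXiv:2211.02515 or a repaired Margin232 until a kernel theorem
says so.»

## References

* [ConreyIwaniec2002] B. Conrey, H. Iwaniec, Acta Arith. 103 (2002) 259–312, arXiv:math/0111012:
  §4 (4.16), (4.18), (4.23), (4.27)–(4.36), Theorems 4.3–4.4; §5 (5.14), (5.16), (5.18); §6
  (6.1)–(6.14), (6.18)–(6.24), (6.27)–(6.29), Theorem 6.1.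
-/

noncomputable section

open Complex MeasureTheory

namespace Literature.NumberTheory.LFunctions

namespace ConreyIwaniec2002

/-! ### The kernel and its cosine transform -/

/-- **`L(v) = 2∫₀^∞ K(u)cos(uv)du`**, the cosine transform (6.2) of the kernel `K` of (5.18)
(so `L(0) = 2∫₀^∞ K` is (6.6)). [cite: ConreyIwaniec2002, §6 (6.2), (6.6)] -/
def ciL (K : ℝ → ℝ) (v : ℝ) : ℝ :=
  2 * ∫ u in Set.Ioi (0 : ℝ), K u * Real.cos (u * v)

/-- **The admissible kernels of §6, (6.1)–(6.3)**: `K` continuous and symmetric on `ℝ` with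
`K(0) = 0` (6.1), compactly supported ("any smooth, symmetric and compactly supported function on
`ℝ ∖ {0}` does satisfy the above conditions up to a constant factor"), whose cosine transform
`L = ciL K` (6.2) is of class `C⁵` with `|L^{(j)}(v)| ≤ (1+|v|)^{-4}` for `0 ≤ j ≤ 5` (6.3).
[cite: ConreyIwaniec2002, §6 (6.1)–(6.3)] -/
def IsCIKernel (K : ℝ → ℝ) : Prop :=
  Continuous K ∧ (∀ u, K (-u) = K u) ∧ K 0 = 0 ∧ HasCompactSupport K ∧
    ContDiff ℝ 5 (ciL K) ∧
      ∀ j : ℕ, j ≤ 5 → ∀ v : ℝ, |iteratedDeriv j (ciL K) v| ≤ ((1 + |v|) ^ 4)⁻¹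

/-- **`D(v) = Σ_{h ≥ 1} σ(h) L(hv)`** (6.29), the off-diagonal main-term series of Theorem 6.1
(`L = ciL K`). [cite: ConreyIwaniec2002, §6 (6.29)] -/
def ciD (K : ℝ → ℝ) (σ : ℕ → ℝ) (v : ℝ) : ℝ :=
  ∑' h : ℕ, σ (h + 1) * ciL K ((h + 1 : ℝ) * v)

/-! ### The shifted-convolution hypothesis (6.19) -/

/-- **The test functions of (4.18)/(4.23)/(6.18)**: `g` of class `C²`, vanishing off the dyadic
segment `[X, 2X]`, with `x^ν |g^{(ν)}(x)| ≤ 1` for `ν = 0, 1, 2` (complex-valued).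
[cite: ConreyIwaniec2002, §4 (4.18), (4.23); §6 (6.18)] -/
def IsBumpOn (X : ℝ) (g : ℝ → ℂ) : Prop :=
  ContDiff ℝ 2 g ∧ (∀ x : ℝ, x ∉ Set.Icc X (2 * X) → g x = 0) ∧
    ∀ ν : ℕ, ν ≤ 2 → ∀ x : ℝ, x ^ ν * ‖iteratedDeriv ν g x‖ ≤ 1

/-- **The shifted-convolution asymptotics (6.19)** for the arithmetic function `λ` with main-term
coefficients `σ` and constant `B` (the absolute implied constant folded into `B`): for `X ≥ 1/2`,
test functions `g₁, g₂` on `[X, 2X]` and `h ≥ 1`,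
`|Σ_{m−n=h} λ(m)λ̄(n)g₁(m)g₂(n) − σ(h)∫g₁(x+h)g₂(x)dx| ≤ B·τ(h)·X^{3/4}(log 3X)²`.
[cite: ConreyIwaniec2002, §6 (6.19); Theorem 4.3 (4.25); Theorem 4.4 (4.26)] -/
def ShiftedConvolutionBound (lam : ℕ → ℂ) (σ : ℕ → ℝ) (B : ℝ) : Prop :=
  ∀ X : ℝ, 1 / 2 ≤ X → ∀ g₁ g₂ : ℝ → ℂ, IsBumpOn X g₁ → IsBumpOn X g₂ → ∀ h : ℕ, 1 ≤ h →
    ‖(∑ n ∈ Finset.Icc 1 ⌊2 * X⌋₊,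
          lam (n + h) * starRingEnd ℂ (lam n) * g₁ ((n : ℝ) + h) * g₂ n) -
        (σ h : ℂ) * ∫ x : ℝ, g₁ (x + h) * g₂ x‖ ≤
      B * (Nat.divisors h).card * X ^ (3 / 4 : ℝ) * Real.log (3 * X) ^ 2

/-! ### The main-term coefficients `σ(h)` of the two examples -/

/-- **The Euler-type factor of the generating series (4.34) of `σ(h)` for the Eisenstein series of
the cusp `1/v`, `q = vw`**: `F_{v,w}(s) = ∏_{p∣v}(p^{-1} − p^{−s}) · ∏_{p∣w}(1 − p^{−s−1})`
(`= v^{-1}∏_{p∣v}(1 − p^{1−s})∏_{p∣w}(1 − p^{−s−1})` for squarefree `v`), so that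
`Z(s) = {μ(v)F_{v,w}(s) + μ(w)F_{w,v}(s)}(ζ_q(2)/ζ(2))ζ(s)ζ(s+1)L²(1,χ)` ((4.34), with the signs of
(4.31)/(4.36)). [cite: ConreyIwaniec2002, §4 (4.34)] -/
def genusZFactor (v w : ℕ) (s : ℂ) : ℂ :=
  (∏ p ∈ v.primeFactors, ((p : ℂ)⁻¹ - (p : ℂ) ^ (-s))) *
    ∏ p ∈ w.primeFactors, (1 - (p : ℂ) ^ (-s - 1))

/-- **The main-term coefficients `σ(h)` occurring for the forms attached to `K = ℚ(√−q)`**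
((6.20)–(6.24) in the two examples of §6, p. 15): the bound `|σ(h)| ≤ 2ℓ²σ₋₁(h)` ((6.20), from
(4.32)), and EITHER `σ = 0` (primitive cusp forms, Theorem 4.3: "`Z = 0` and `C = 0`") OR the
generating series (4.34) of the Eisenstein series of the cusp `1/v`, `q = vw`:
`Σ_h σ(h)h^{-s} = κℓ²(ε₁F_{v,w}(s) + ε₂F_{w,v}(s))ζ(s)ζ(s+1)` on `Re s > 1`, with `0 ≤ κ ≤ 1`
(`κ = ζ_q(2)/ζ(2)`) and `|ε₁|, |ε₂| ≤ 1` (`= μ(v), μ(w)`); `ℓ = L(1,χ)`.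
[cite: ConreyIwaniec2002, §4 (4.32)–(4.34); §6 (6.20)–(6.26)] -/
def IsCISigma (q : ℕ) (ℓ : ℝ) (σ : ℕ → ℝ) : Prop :=
  (∀ h : ℕ, 1 ≤ h → |σ h| ≤ 2 * ℓ ^ 2 * ∑ d ∈ Nat.divisors h, (d : ℝ)⁻¹) ∧
    (σ = 0 ∨
      ∃ (v w : ℕ) (κ ε₁ ε₂ : ℝ), v * w = q ∧ 0 ≤ κ ∧ κ ≤ 1 ∧ |ε₁| ≤ 1 ∧ |ε₂| ≤ 1 ∧
        ∀ s : ℂ, 1 < s.re →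
          LSeries (fun h ↦ (σ h : ℂ)) s =
            κ * ℓ ^ 2 * (ε₁ * genusZFactor v w s + ε₂ * genusZFactor w v s) *
              riemannZeta s * riemannZeta (s + 1))

/-! ### The intermediate statements of Theorem 6.1 (registered stub interfaces S2a/S2b of SKELETON P64) -/

/-- **The cut-off class (6.14)**: `a` of class `𝒞²` on `ℝ⁺` with `y^ν |a^{(ν)}(y)| ≤ (1 + y/Y)^{-4}`
for `ν = 0, 1, 2` (the class of Theorem 6.1 itself; Corollary 6.2 reaches the class (6.38) by
`a(y) ↦ a(y)√(T/y)`). [cite: ConreyIwaniec2002, §6 (6.14)] -/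
def IsCutoff14 (a : ℝ → ℂ) (Y : ℝ) : Prop :=
  ContDiffOn ℝ 2 a (Set.Ioi 0) ∧
    ∀ ν : ℕ, ν ≤ 2 → ∀ y : ℝ, 0 < y → y ^ ν * ‖iteratedDeriv ν a y‖ ≤ ((1 + y / Y) ^ 4)⁻¹

/-- **(6.4)–(6.12), the generic part of Theorem 6.1, with constant `c`**: for an admissible kernel
`K` (`L = ciL K`) and any complex sequence `(a_n)_{n ≥ 1}` with `Σ n²|a_n|² < ∞`,
`∫ K(t/T)|Σ a_n n^{-it}|² dt = L(0)·T·G + 2T·Re Σ_{1 ≤ h ≤ H} S*(h) + E`,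
`S*(h) = Σ_n a_{n+h} ā_n L(hT/n)` (6.9), `G = Σ|a_n|²` (5.16), with
`|E| ≤ c (G₁/T + G₂/(TH) + (Σ|a_n|)²/T³)`, `G₁ = Σ n|a_n|²` (5.14), `G₂ = Σ n²|a_n|²` (6.11)
((6.5): `𝒜(T) = L(0)TG + 2T Re Σ_{h>0} S(h)`; (6.7)–(6.8): Taylor `L(T log(m/n)) = L(hT/n) + O(T⁻¹(1+hT/n)⁻²)`
for `n ≥ h`; (6.10): `S*(h) ≪ (hT)⁻²G₂` beyond `H`; the terms `n < h` are `O(T⁻³(Σ|a_n|)²)` by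
`|L(x)| ≤ (1+x)⁻⁴`, the source's `T⁻³Y^{9/4}` in (6.31)). [cite: ConreyIwaniec2002, §6 (6.4)–(6.12)] -/
def Thm61Generic (c : ℝ) : Prop :=
  ∀ K : ℝ → ℝ, IsCIKernel K → ∀ a : ℕ → ℂ, a 0 = 0 →
    Summable (fun n : ℕ ↦ (n : ℝ) ^ 2 * ‖a n‖ ^ 2) → ∀ T : ℝ, 0 < T → ∀ H : ℕ, 1 ≤ H →
      abs ((∫ t : ℝ, K (t / T) * ‖LSeries a (t * I)‖ ^ 2) - ciL K 0 * T * (∑' n : ℕ, ‖a n‖ ^ 2) -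
          2 * T * (∑ h ∈ Finset.Icc 1 H, ∑' n : ℕ,
            a (n + h) * starRingEnd ℂ (a n) * (ciL K (h * T / n) : ℂ)).re) ≤
        c * ((∑' n : ℕ, (n : ℝ) * ‖a n‖ ^ 2) / T + (∑' n : ℕ, (n : ℝ) ^ 2 * ‖a n‖ ^ 2) / (T * H) +
          (∑' n : ℕ, ‖a n‖) ^ 2 / T ^ 3)

/-- **(6.27)–(6.28), the evaluation of `S*(h)` from the shifted-convolution asymptotics (6.19),
with constant `c`**: for `K` admissible, `|λ(n)| ≤ τ(n)` (6.15), `|σ(h)| ≤ C₁σ₋₁(h)` (6.20), (6.19)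
with constant `B₁`, `a` in the class (6.14) with `Y ≥ 2`, `T ≥ 1` and `h ≥ 1`:
`S*(h) = Σ_n λ(n+h)a(n+h)·conj(λ(n)a(n))·L(hT/n) = σ(h)∫₀^∞|a(y)|²L(hT/y)dy
  + O(τ(h)[(1+B₁)Y^{3/4}(1+log hY)⁴ + (1+C₁)(Y²T⁻²h⁻¹ + hT⁻²(1+log hY)³)])`
— term by term as in print: (6.19) on a smooth dyadic partition of unity (`B₁τ(h)Y^{3/4}(log Y)⁴`);
separated constituents vanish unless `Y₁, Y₂ ≤ √2 h`, where the sum is `≪ T⁻²h(log 3h)³` and the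
integral `≪ T⁻²h|σ(h)|`; then `a(y+h) ↦ a(y)` at the cost `O(Y²T⁻²h⁻¹|σ(h)|)` (no logarithm). The
convention `a(0) = 0` removes the `n = 0` term. [cite: ConreyIwaniec2002, §6 (6.27)–(6.28)] -/
def Thm61ShiftedSum (c : ℝ) : Prop :=
  ∀ K : ℝ → ℝ, IsCIKernel K → ∀ (lam : ℕ → ℂ) (σ : ℕ → ℝ) (B₁ C₁ : ℝ), 0 ≤ B₁ → 0 ≤ C₁ →
    (∀ n : ℕ, 1 ≤ n → ‖lam n‖ ≤ (Nat.divisors n).card) →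
      (∀ h : ℕ, 1 ≤ h → |σ h| ≤ C₁ * ∑ d ∈ Nat.divisors h, (d : ℝ)⁻¹) →
        ShiftedConvolutionBound lam σ B₁ →
          ∀ (T Y : ℝ) (a : ℝ → ℂ), 1 ≤ T → 2 ≤ Y → IsCutoff14 a Y → a 0 = 0 → ∀ h : ℕ, 1 ≤ h →
            ‖(∑' n : ℕ, lam (n + h) * a ((n : ℝ) + h) * starRingEnd ℂ (lam n * a n) *
                  (ciL K (h * T / n) : ℂ)) -
                (σ h : ℂ) * ((∫ y in Set.Ioi (0 : ℝ), ‖a y‖ ^ 2 * ciL K (h * T / y) : ℝ) : ℂ)‖ ≤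
              c * (Nat.divisors h).card *
                ((1 + B₁) * Y ^ (3 / 4 : ℝ) * (1 + Real.log (h * Y)) ^ 4 +
                  (1 + C₁) * (Y ^ 2 / (T ^ 2 * h) + h * (1 + Real.log (h * Y)) ^ 3 / T ^ 2))

end ConreyIwaniec2002

end Literature.NumberTheory.LFunctions

end
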